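import Literature.AlgebraicGeometry.Resolution.PointBlowupIntersectionMultiplicityFinite
import Literature.AlgebraicGeometry.Resolution.MarkedIdeals
import Literature.AlgebraicGeometry.Resolution.Blowups
import Mathlib.AlgebraicGeometry.IdealSheaf.Subscheme
import Mathlib.AlgebraicGeometry.Morphisms.ClosedImmersion
import Mathlib.AlgebraicGeometry.FunctionField
import Mathlib.RingTheory.Length
import Mathlib.RingTheory.RegularLocalRing.Defs
import HarnessLib

/-!
# The intersection multiplicity of a regular curve with a closed subscheme drops under blowing up the point
# (The Stacks Project, Lemma 54.15.3 = Tag 0BI7, with (54.15.2.1) = Tag 0BI6) — named fact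

Topic: `Literature/AlgebraicGeometry/Resolution`. Companion of `EmbeddedResolutionCurvesInSurfaces.lean`
(Stacks Lemma 54.15.6 = Tag 0BIC, desk labels F-75 / F-75c): the LOCAL step used in the second paragraph of
the proof of Lemma 54.15.6 («If the maximum of these numbers is `> 1`, then we can decrease it (Lemma 54.15.3)
by blowing up in all the points `p` where the maximum is attained»). Asked for as a NEED-FACT by the crux desk
of cell res-hironaka, rung L W4.2 (RULING v3.14-48 (PD)(iv), 2026-08-27: the «tangency half» of a lineage-local
termination measure for the snc phase; the «singular-branch half» is the PROVED `δ`-drop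
`IsBlowup.sum_curveDelta_fibre_lt`, `BlowupPointDeltaDrop.lean`).

## What is printed (The Stacks Project, Chapter 54 «Resolution of Surfaces», §54.15 «Embedded resolution»;
## TAGS are the stable locator; texts read by read-only GET 2026-08-27, copies under the cell's HOME
## `lit/res-lit-6/stacks/tag-0BI7.txt`, `tag-0BI6.txt`)

* **Situation (section text before Lemma 54.15.3, Tag 0BI3).** «Let `X` be a locally Noetherian scheme. Let
  `Y, Z ⊂ X` be closed subschemes. Let `p ∈ Y ∩ Z` be a closed point. Assume that `Y` is integral of dimension
  `1` and that the generic point of `Y` is not contained in `Z`. In this situation we can consider the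
  invariant (54.15.2.1) [Tag 0BI6] `m_p(Y ∩ Z) = length_{𝒪_{X,p}}(𝒪_{Y∩Z,p})`. This is an integer `≥ 1`.
  Namely, if `I, J ⊂ 𝒪_{X,p}` are the ideals corresponding to `Y, Z`, then we see that
  `𝒪_{Y∩Z,p} = 𝒪_{X,p}/I + J` has support equal to `{𝔪_p}` because we assumed that `Y ∩ Z` does not
  contain the unique point of `Y` specializing to `p`. Hence the length is finite by Algebra, Lemma 10.62.3.»
* **Lemma 54.15.3 (Tag 0BI7).** «In the situation above let `X' → X` be the blowing up of `X` in `p`. Let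
  `Y', Z' ⊂ X'` be the strict transforms of `Y, Z`. If `𝒪_{Y,p}` is regular, then (1) `Y' → Y` is an
  isomorphism, (2) `Y'` meets the exceptional fibre `E ⊂ X'` in one point `q` and `m_q(Y ∩ E) = 1`
  [sic — read `m_q(Y' ∩ E)`], (3) if `q ∈ Z'` too, then `m_q(Y ∩ Z') < m_p(Y ∩ Z)` [sic — read
  `m_q(Y' ∩ Z')`].» Proof (Tag 0BI7): `x₁ ∈ 𝔪_p` mapping to a uniformizer of the discrete valuation ring
  `𝒪_{Y,p}`; `p` is an effective Cartier divisor on `Y` and `Y'` is the blowing up of `Y` in `p`, hence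
  `Y' → Y` is an isomorphism; on the chart `A[𝔪/x₁]` the image of `x₁` cuts out `E`, so `m_q(Y', E) = 1`;
  for `f ∈ J` with `f̄ ∈ A/I` of minimal valuation `m_p(Y ∩ Z)`, `f/x₁ ∈ J'` has valuation one less.

## What is typed

`Stacks0BI7_intersectionMultiplicityDrop` — in the tree's language of blowing ups by the universal property
(`IsBlowup`, `Blowups.lean`), stalks of ideal sheaves (`stalkIdeal`, `MarkedIdeals.lean`) and scheme-theoretic
strict transforms of closed subschemes as ideal sheaves (`strictTransformIdeal π C K = ⋃ₙ (π^*K : 𝓘(E)ⁿ)`,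
`MarkedIdeals.lean`; = Stacks Tag 080D, Görtz–Wedhorn (13.19)):

* binders: `X` locally Noetherian; the curve `Y` is given by a CLOSED IMMERSION `i : Y ⟶ X` (ideal sheaf
  `i.ker`) with `Y` integral, `topologicalKrullDim Y = 1`, a point `y` of `Y` over `p` with `𝒪_{Y,y}` a
  regular local ring; `Z` is a closed subscheme given by its ideal sheaf `J : X.IdealSheafData`; `p` is a
  closed point of `X` lying on `Z` (`p ∈ J.support`; `p ∈ Y` is `i y = p`); the generic point of `Y` does not
  lie on `Z` (`i (genericPoint Y) ∉ J.support`); `π : X' ⟶ X` is a blowing up of `X` in `p`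
  (`IsBlowup π (vanishingIdeal {p})`, the reduced point); `E := (vanishingIdeal {p}).comap π` (the
  exceptional fibre as an ideal sheaf, support `π⁻¹(p)`), `Y' := strictTransformIdeal π (vanishingIdeal {p})
  i.ker`, `Z' := strictTransformIdeal π (vanishingIdeal {p}) J`;
* the invariant (54.15.2.1): `m_p(Y ∩ Z) := Module.length 𝒪_{X,p} (𝒪_{X,p} ⧸ (I_p ⊔ J_p))` in `ℕ∞`, with
  `I_p = stalkIdeal i.ker p`, `J_p = stalkIdeal J p` (finite, `≥ 1`, by the situation text — not re-asserted);
* conclusions: (1) an isomorphism `V(Y') ≅ Y` over `π` and `i` (Mathlib's `Scheme.IdealSheafData.subscheme` /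
  `subschemeι`; a morphism `V(Y') → Y` compatible with the two closed immersions is unique, so «∃ an
  isomorphism over `X`» is «`Y' → Y` is an isomorphism»); (2) `V(Y') ∩ π⁻¹(p) = {q}` for one point `q` of `X'`
  with `Module.length 𝒪_{X',q} (𝒪_{X',q} ⧸ (Y'_q ⊔ E_q)) = 1`; (3) if `q ∈ V(Z')` then
  `Module.length 𝒪_{X',q} (𝒪_{X',q} ⧸ (Y'_q ⊔ Z'_q)) < m_p(Y ∩ Z)` (strict inequality AS PRINTED; the proof's
  «one less» is an upper bound `≤ m_p − 1`, the strict transform `Z'` may drop more).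

FLAGS. (i) AS PRINTED up to encoding: `X` ANY locally Noetherian scheme (no regularity, no dimension bound on
`X`), `Z` any closed subscheme; the curve is presented by a closed immersion rather than as a subset — the
printed «`Y ⊂ X` closed subscheme, integral of dimension `1`, `𝒪_{Y,p}` regular» verbatim on the source `Y`.
(ii) The two printed «`Y ∩`» in (2)–(3) are typed as «`Y' ∩`» (the only reading under which the terms are
defined: `Y ⊂ X`, `E, Z' ⊂ X'`; the proof computes `m_q(Y', E)` and the valuation in `A/I ≅ 𝒪_{Y',q}`) — `sic`
recorded above, no `_ours` sibling needed since the literal reading has no meaning. (iii) Not a statement of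
H. Hironaka's 2017 manuscript; a published lemma typed for the L-lane of cell res-hironaka. No definitions,
instances or notation introduced. AI-typed; weaker than expert review. Statement only (`def … : Prop`); users
take `(h : Stacks0BI7_intersectionMultiplicityDrop)`. Size of a proof over the tree (estimate, NOTES of the
typer): M — `IsBlowup.isIso` + «a closed point of a curve with DVR local ring is an effective Cartier divisor»
for (1), the chart algebra `A[𝔪/x₁] → A/I` of the printed proof for (2)–(3).

## References

* The Stacks Project, Tag 0BI7 (Lemma 54.15.3), Tag 0BI6 ((54.15.2.1)), Tag 0BI3 (Section 54.15, situation),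
  Tag 080D/080E (strict transform; = blowing up in the pulled-back centre), Tag 0BIC (Lemma 54.15.6, the use).
  [StacksProject]
* U. Görtz, T. Wedhorn, *Algebraic Geometry I*, 2nd ed. (2020), (13.19) p. 414 (strict transform as the
  schematic closure of `π⁻¹(Y ∖ Z)`; the tree's `strictTransformIdeal`). [GortzWedhorn2020]
-/

noncomputable section

open CategoryTheory AlgebraicGeometry TopologicalSpace IsLocalRing

namespace Literature.AlgebraicGeometry.Resolution

universe u

open Scheme.IdealSheafData

/-- NAMED FACT — **The Stacks Project, Lemma 54.15.3 (Tag 0BI7): under blowing up a closed point `p`, the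
strict transform of a curve `Y` regular at `p` maps isomorphically to `Y`, meets the exceptional fibre in one
point `q` with multiplicity `1`, and its intersection multiplicity with the strict transform of any closed
subscheme `Z ∋ p` at `q` is smaller than `m_p(Y ∩ Z)`.** Situation (Tag 0BI3): «Let `X` be a locally
Noetherian scheme. Let `Y, Z ⊂ X` be closed subschemes. Let `p ∈ Y ∩ Z` be a closed point. Assume that `Y` is
integral of dimension `1` and that the generic point of `Y` is not contained in `Z`», with
`m_p(Y ∩ Z) = length_{𝒪_{X,p}}(𝒪_{Y∩Z,p}) = length_{𝒪_{X,p}}(𝒪_{X,p}/I + J)` ((54.15.2.1), Tag 0BI6). Lemma: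
«let `X' → X` be the blowing up of `X` in `p`. Let `Y', Z' ⊂ X'` be the strict transforms of `Y, Z`. If
`𝒪_{Y,p}` is regular, then (1) `Y' → Y` is an isomorphism, (2) `Y'` meets the exceptional fibre `E ⊂ X'` in
one point `q` and `m_q(Y[′] ∩ E) = 1`, (3) if `q ∈ Z'` too, then `m_q(Y[′] ∩ Z') < m_p(Y ∩ Z)`.» Typed with
the curve given by a closed immersion `i : Y ⟶ X` (`Y` integral, `topologicalKrullDim Y = 1`, `𝒪_{Y,y}`
regular at the point `y` over `p`), `Z = V(J)`, the blowing up by the universal property along the reduced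
point (`IsBlowup π (vanishingIdeal {p})`), `E = π^*𝓘_{p}`, strict transforms as the ideal sheaves
`strictTransformIdeal π 𝓘_{p} (·)` (Stacks 080D), multiplicities as `Module.length` of
`𝒪 ⧸ (stalkIdeal · ⊔ stalkIdeal ·)` in `ℕ∞`; (1) as an isomorphism `V(Y') ≅ Y` over `X`. As printed (two
«`Y ∩`» read «`Y' ∩`», sic). Statement only; users take `(h : Stacks0BI7_intersectionMultiplicityDrop)`.
[cite: StacksProject, Tag 0BI7 (Lemma 54.15.3); Tag 0BI6 ((54.15.2.1)); Tag 0BI3 (§54.15, situation)] -/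
def Stacks0BI7_intersectionMultiplicityDrop : Prop :=
  ∀ (X Y : Scheme.{u}) [IsLocallyNoetherian X] [IsIntegral Y] (i : Y ⟶ X) [IsClosedImmersion i]
    (J : X.IdealSheafData) (p : X) (hp : IsClosed ({p} : Set X)) (y : Y),
    topologicalKrullDim Y = 1 → i y = p → IsRegularLocalRing (Y.presheaf.stalk y) →
    p ∈ J.support → i (genericPoint Y) ∉ J.support →
    ∀ (X' : Scheme.{u}) (π : X' ⟶ X), IsBlowup π (vanishingIdeal ⟨{p}, hp⟩) →
      -- (1) `Y' → Y` is an isomorphism (over `X`)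
      (∃ e : (strictTransformIdeal π (vanishingIdeal ⟨{p}, hp⟩) i.ker).subscheme ≅ Y,
          e.hom ≫ i = (strictTransformIdeal π (vanishingIdeal ⟨{p}, hp⟩) i.ker).subschemeι ≫ π) ∧
      -- (2) `Y' ∩ E = {q}` with `m_q(Y' ∩ E) = 1`, and (3) `q ∈ Z' ⇒ m_q(Y' ∩ Z') < m_p(Y ∩ Z)`
      ∃ q : X',
        ((strictTransformIdeal π (vanishingIdeal ⟨{p}, hp⟩) i.ker).support : Set X') ∩ π ⁻¹' {p} = {q} ∧
        Module.length (X'.presheaf.stalk q) (X'.presheaf.stalk q ⧸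
          (stalkIdeal (strictTransformIdeal π (vanishingIdeal ⟨{p}, hp⟩) i.ker) q ⊔
            stalkIdeal ((vanishingIdeal ⟨{p}, hp⟩).comap π) q)) = 1 ∧
        (q ∈ (strictTransformIdeal π (vanishingIdeal ⟨{p}, hp⟩) J).support →
          Module.length (X'.presheaf.stalk q) (X'.presheaf.stalk q ⧸
              (stalkIdeal (strictTransformIdeal π (vanishingIdeal ⟨{p}, hp⟩) i.ker) q ⊔
                stalkIdeal (strictTransformIdeal π (vanishingIdeal ⟨{p}, hp⟩) J) q)) <
            Module.length (X.presheaf.stalk p) (X.presheaf.stalk p ⧸ (stalkIdeal i.ker p ⊔ stalkIdeal J p)))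

/-- **Stacks Lemma 54.15.3 (Tag 0BI7) HOLDS** — discharge of the named fact: the statement above is the
theorem `Stacks0BI7_intersectionMultiplicityDrop_proof` of `PointBlowupIntersectionMultiplicityFinite.lean`
(clause (1) chart-free through the universal property — the strict transform of `Y` is the blow-up of `Y`
in the effective Cartier divisor `i^*𝓘_{p}`, Tags 080E and 0807 —, clauses (2)–(3) by transporting the
lengths to `𝒪_{Y,p}` (Tag 00IX) and a Nakayama step). Users' hypotheses
`(h : Stacks0BI7_intersectionMultiplicityDrop)` are fed this theorem. AI-formalized from the printed proof;
weaker than expert review. [cite: StacksProject, Tag 0BI7 (Lemma 54.15.3)] -/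
theorem Stacks0BI7_intersectionMultiplicityDrop_holds : Stacks0BI7_intersectionMultiplicityDrop :=
  Stacks0BI7_intersectionMultiplicityDrop_proof

end Literature.AlgebraicGeometry.Resolution

end
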